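import Summits.ResolutionOfSingularities.ResolutionOfSingularities.Theorems.WeightedInvariantWeightedThesisHypersurfaceStrategy
import HarnessLib

/-!
# The tower step of a centre rule is functional (door `HypersurfaceCentreConstruction`, H1a)

Route `ResolutionOfSingularities/WeightedInvariant`, crux `Theses.WeightedInvariant.HypersurfaceCentreConstruction`
(stmt-ResolutionOfSingularities-19897), door line `local-engine`, CRUX-PLAN r1 of `res-L1-w43-plan-1`
(sketch `L/res-L1-w43-plan-1/door_globalize_sketch.lean`, sha16 `4548141fdf78465f`): helper **H1a
`(G-step1)`** — the tower-step relation `HypersurfacePair.Step c` of ANY centre rule `c` is functional: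
a hypersurface pair has at most one `Step`-successor.  Reason: `Step c P' P` says `P'` is the global
cobordant blow-up of `P` along SOME Rees filtration `R'` whose pieces are those of the centre `c P`; a
`ReesFiltration` is the datum of its pieces `ideal : ℕ → 𝒪_Y-ideals` plus three propositions, so `R'`
is determined by the centre, and the remaining data of the successor pair (smoothness, separatedness,
quasi-compactness, local principality, integrality) are propositions.

Consequence used by H1 (the `(G-rank)` packaging, file `…HypersurfaceCentreChoiceToDatum.lean`): along a
well-founded functional relation the height of a pair is a natural number that drops by exactly one at
its successor.

Nothing here is a claim about Hironaka's problem; `Step` is a predicate of the line (Włodarczyk 2022,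
Def. 2.3.5 / §3.3 shape), and the statements below are folklore bookkeeping about it.
-/

noncomputable section

open CategoryTheory AlgebraicGeometry TopologicalSpace
open Literature.AlgebraicGeometry.Resolution

set_option linter.dupNamespace false -- mandated namespace of this single-conjunct summit

namespace Summit.ResolutionOfSingularities.ResolutionOfSingularities.Theorems

/-- **A Rees filtration is determined by its pieces**: two Rees filtrations on `Y` with the same
`ideal` field are equal (the other three fields are propositions). [folklore] -/
theorem reesFiltration_eq_of_ideal_eq {Y : Scheme.{0}} {R₁ R₂ : ReesFiltration Y}
    (h : R₁.ideal = R₂.ideal) : R₁ = R₂ := by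
  obtain ⟨f₁, _, _, _⟩ := R₁
  obtain ⟨f₂, _, _, _⟩ := R₂
  obtain rfl : f₁ = f₂ := h
  rfl

namespace HypersurfacePair

variable {k : Type} [Field k]

/-- **H1a `(G-step1)` — the tower step is functional**: for every centre rule `c`, a hypersurface
pair `P` has at most one `Step c`-successor.  Both successors are the global cobordant blow-up of `P`
along a Rees filtration with pieces `(c P.f P.X).piece`; such a filtration is unique
(`reesFiltration_eq_of_ideal_eq`), and the remaining data of a hypersurface pair are propositions.
Signature = the sketch's `step_subsingleton` (door_globalize_sketch.lean l.44–49). [folklore] -/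
theorem step_subsingleton
    (ctr : ∀ ⦃Y : Scheme.{0}⦄, (Y ⟶ Spec (.of k)) → Y.IdealSheafData → ReesAlgebraData Y)
    (P P₁ P₂ : HypersurfacePair k) (h₁ : HypersurfacePair.Step ctr P₁ P)
    (h₂ : HypersurfacePair.Step ctr P₂ P) : P₁ = P₂ := by
  obtain ⟨_, R₁, hR₁, hs₁, hsep₁, hqc₁, hlp₁, hint₁, rfl⟩ := h₁
  obtain ⟨_, R₂, hR₂, hs₂, hsep₂, hqc₂, hlp₂, hint₂, rfl⟩ := h₂
  obtain rfl : R₁ = R₂ := reesFiltration_eq_of_ideal_eq (hR₁.trans hR₂.symm)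
  rfl

/-- The functional step, stated as: any two `Step c`-successors of the same pair coincide
(argument order of `Step.subsingleton`-style use). [folklore] -/
theorem Step.eq_of_step
    {c : ∀ ⦃Y : Scheme.{0}⦄, (Y ⟶ Spec (.of k)) → Y.IdealSheafData → ReesAlgebraData Y}
    {P P₁ P₂ : HypersurfacePair k} (h₁ : Step c P₁ P) (h₂ : Step c P₂ P) : P₁ = P₂ :=
  step_subsingleton c P P₁ P₂ h₁ h₂

/-- A `Step`-predecessor is a singular pair (first clause of `Step`). [folklore] -/
theorem Step.not_isRegular
    {c : ∀ ⦃Y : Scheme.{0}⦄, (Y ⟶ Spec (.of k)) → Y.IdealSheafData → ReesAlgebraData Y}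
    {P P' : HypersurfacePair k} (h : Step c P' P) : ¬ Scheme.IsRegular P.X.subscheme :=
  h.1

end HypersurfacePair

end Summit.ResolutionOfSingularities.ResolutionOfSingularities.Theorems

end
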